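import Summits.CriticalPhenomena.PercolationContinuityZ3.Theorems.PercNearOneGluingNoHeavyLowerTailPairObserverIntegralBase
import Summits.CriticalPhenomena.PercolationContinuityZ3.Theorems.PercNearOneGluingNoHeavyLowerTailCILTwoPendantStars
import HarnessLib

/-!
# `NoHeavyLowerTail` (stmt-CriticalPhenomena-4575) — the induction shell of the two-sided kernel (DC): everything except the
# OUTSIDER STEP is proved, so (DC) for two pendant stars is formally reduced to one statement about relays outside the ports

Support file (prover `prim-hp-3`, hull-port line; `--supports stmt-CriticalPhenomena-4575`).  No definitions, no named facts, no sorries.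

SETTING (all hypotheses inline).  `μ_w = prodBernoulli w` on `Fin n`, relays `A`, level `j`; TWO PENDANT STARS: observers `o₁ ≠ o₂`, both
`∉ A`, `w s(o₁,o₂) = 0`, and every pair of nonzero weight at `o₁` or at `o₂` goes to a relay (the PORTS; a port may serve both observers; the star
weights ("coins") are arbitrary in `[0,1]`, weight `1` = glued port).  `O = {o₁,o₂}`, `π(v) = {z ∈ A : v ↔ z}`, `π(O) = π(o₁) ∪ π(o₂)`,
`I_w(v) = μ_w{|π(v)| ≤ j}` and the E-MASS `E_w(v) = μ_w(v ↮ O, 1 ≤ |π(O)| ≤ j) + μ_w(v ↔ O, |π(v)| ≤ j)` (file `…OutsiderPortStep.lean`).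
(DC) for `w`:  **for every relay `v ∈ A` there is a relay `p ∈ A` which is a port (or `E_w(v) = 0`) with `E_w(v) ≤ I_w(p)`** — i.e.
`E_w(v) ≤ max_{ports} I_w`; it contains PORT-QOSL, TPS-domination and, via `cil_twoPendantStars_of_TPS`, CIL for the two-pendant-stars observer
(crux notes `run/shared/lean/prim/prim-hp-3/HULLPORT-REF-gen5.md` §0, `…-gen6.md` §9; ttrl census halflin/PORTQOSL.md: 0 violations).

THE INDUCTION (on the number `N(w)` of star pairs `s(o_s,a)`, `a ∈ A`, with weight strictly between `0` and `1`):
* BASE (`N = 0`, companion file `…PairObserverIntegralBase.lean`, `HullPort.obsE_pair_le_port_of_integral`): every star pair has weight `0` or `1`;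
  each observer is glued to its weight-one ports or isolated.
* ports with a fractional pair: the PORT STEP `obsE_le_max_of_erase` / `obsE_le_of_common_witness` + `obsE_weight_one_le` and the hypothesis one
  pair down; glued ports: `obsE_weight_one_le`.
* relays outside the ports: this is the only place where something new is needed — the OUTSIDER STEP, taken as a HYPOTHESIS in the literal form
  "given (DC) for every two-pendant-stars weight function with fewer fractional star pairs, (DC) holds at `w` for the outsider `v`".

* `HullPort.dc_of_outsiderStep` : OUTSIDER STEP (for all instances) → (DC) (for all instances).
* `HullPort.outsiderStep_of_condOut` : the one-step law COND-OUT → OUTSIDER STEP, where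
  COND-OUT: for an outsider `v` and an instance with a fractional star pair there are a fractional star pair `e = s(a,o_s)` and a port `t` of `w`
  (possibly `a` itself) no heavier in `w[e↦0]` than every port of `w[e↦0]` with `E_{w[e↦1]}(v) ≤ I_{w[e↦1]}(t)` (then `t` is a common witness:
  `obsE_le_of_common_witness`).  Exact census of COND-OUT (seat, memo gen6 §9): 0 failures in ≈ 11 600 (instance, outsider) pairs including
  the families on which the qualitative laws GOOD-EDGE / CHAIN-AB of the TPS-dom induction fail; ttrl request `hp3-condout-dc-induction`.
* `HullPort.dc_of_condOut` : COND-OUT → (DC).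
* `HullPort.cil_twoPendantStars_of_condOut` : COND-OUT (for the reference weight function `w_o`) → CIL at a two-pendant-stars observer `o`
  with the `H`-champion as witness (`cil_twoPendantStars_of_TPS` with its hypothesis TPS discharged by (DC)).
-/

noncomputable section

namespace Summit.CriticalPhenomena.PercolationContinuityZ3.Theorems

open MeasureTheory Set Literature.Probability.LatticeModels Literature.Probability.Percolation
open scoped Classical BigOperators

variable {n : ℕ}

namespace HullPort

/-! ### The induction shell -/

/-- **(DC) from the OUTSIDER STEP.**  Hypothesis `hOut` (the outsider step, for all two-pendant-stars weight functions on `Fin n` with the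
relays `A`, observers `o₁, o₂`, level `j`): if (DC) holds for every two-pendant-stars `w'` with fewer star pairs of weight in `(0,1)` than `w`,
then for every relay `v ∈ A` outside the ports of `w` (`w s(o₁,v) = w s(o₂,v) = 0`), provided `w` has a star pair of weight in `(0,1)`, there is
a port `p` (or `E_w(v) = 0`) with `E_w(v) ≤ I_w(p)`.  Conclusion: (DC) for every two-pendant-stars `w`.  Induction on the number of fractional
star pairs: base `obsE_pair_le_port_of_integral`; ports by the port step (`obsE_le_max_of_erase`, `obsE_le_of_common_witness`,
`obsE_weight_one_le`); outsiders by `hOut`. [this work] -/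
theorem dc_of_outsiderStep (A : Finset (Fin n)) (o₁ o₂ : Fin n) (j : ℕ)
    (hOut : ∀ w : Sym2 (Fin n) → unitInterval,
      o₁ ∉ A → o₂ ∉ A → o₁ ≠ o₂ → w s(o₁, o₂) = 0 → (∀ u, w s(o₁, u) ≠ 0 → u ∈ A) → (∀ u, w s(o₂, u) ≠ 0 → u ∈ A) →
      -- induction hypothesis: (DC) for every two-pendant-stars `w'` with fewer fractional star pairs
      (∀ w' : Sym2 (Fin n) → unitInterval,
        w' s(o₁, o₂) = 0 → (∀ u, w' s(o₁, u) ≠ 0 → u ∈ A) → (∀ u, w' s(o₂, u) ≠ 0 → u ∈ A) →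
        (A.filter fun x => w' s(o₁, x) ≠ 0 ∧ w' s(o₁, x) ≠ 1).card + (A.filter fun x => w' s(o₂, x) ≠ 0 ∧ w' s(o₂, x) ≠ 1).card <
          (A.filter fun x => w s(o₁, x) ≠ 0 ∧ w s(o₁, x) ≠ 1).card + (A.filter fun x => w s(o₂, x) ≠ 0 ∧ w s(o₂, x) ≠ 1).card →
        ∀ v ∈ A, ∃ p ∈ A, ((prodBernoulli w').real {ω : BondConfig (Fin n) | (∀ x ∈ ({o₁, o₂} : Finset (Fin n)), ω ∉ openConn v x) ∧
              1 ≤ (A.filter fun z => ∃ x ∈ ({o₁, o₂} : Finset (Fin n)), ω ∈ openConn x z).card ∧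
              (A.filter fun z => ∃ x ∈ ({o₁, o₂} : Finset (Fin n)), ω ∈ openConn x z).card ≤ j} +
            (prodBernoulli w').real {ω : BondConfig (Fin n) | (∃ x ∈ ({o₁, o₂} : Finset (Fin n)), ω ∈ openConn v x) ∧
              (A.filter fun z => ω ∈ openConn v z).card ≤ j} = 0 ∨ w' s(o₁, p) ≠ 0 ∨ w' s(o₂, p) ≠ 0) ∧
          (prodBernoulli w').real {ω : BondConfig (Fin n) | (∀ x ∈ ({o₁, o₂} : Finset (Fin n)), ω ∉ openConn v x) ∧
              1 ≤ (A.filter fun z => ∃ x ∈ ({o₁, o₂} : Finset (Fin n)), ω ∈ openConn x z).card ∧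
              (A.filter fun z => ∃ x ∈ ({o₁, o₂} : Finset (Fin n)), ω ∈ openConn x z).card ≤ j} +
            (prodBernoulli w').real {ω : BondConfig (Fin n) | (∃ x ∈ ({o₁, o₂} : Finset (Fin n)), ω ∈ openConn v x) ∧
              (A.filter fun z => ω ∈ openConn v z).card ≤ j} ≤
          (prodBernoulli w').real {ω : BondConfig (Fin n) | (A.filter fun z => ω ∈ openConn p z).card ≤ j}) →
      -- the outsider and a fractional star pair
      ∀ v ∈ A, w s(o₁, v) = 0 → w s(o₂, v) = 0 →
      (∃ a ∈ A, (w s(o₁, a) ≠ 0 ∧ w s(o₁, a) ≠ 1) ∨ (w s(o₂, a) ≠ 0 ∧ w s(o₂, a) ≠ 1)) →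
      ∃ p ∈ A, ((prodBernoulli w).real {ω : BondConfig (Fin n) | (∀ x ∈ ({o₁, o₂} : Finset (Fin n)), ω ∉ openConn v x) ∧
            1 ≤ (A.filter fun z => ∃ x ∈ ({o₁, o₂} : Finset (Fin n)), ω ∈ openConn x z).card ∧
            (A.filter fun z => ∃ x ∈ ({o₁, o₂} : Finset (Fin n)), ω ∈ openConn x z).card ≤ j} +
          (prodBernoulli w).real {ω : BondConfig (Fin n) | (∃ x ∈ ({o₁, o₂} : Finset (Fin n)), ω ∈ openConn v x) ∧
            (A.filter fun z => ω ∈ openConn v z).card ≤ j} = 0 ∨ w s(o₁, p) ≠ 0 ∨ w s(o₂, p) ≠ 0) ∧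
        (prodBernoulli w).real {ω : BondConfig (Fin n) | (∀ x ∈ ({o₁, o₂} : Finset (Fin n)), ω ∉ openConn v x) ∧
            1 ≤ (A.filter fun z => ∃ x ∈ ({o₁, o₂} : Finset (Fin n)), ω ∈ openConn x z).card ∧
            (A.filter fun z => ∃ x ∈ ({o₁, o₂} : Finset (Fin n)), ω ∈ openConn x z).card ≤ j} +
          (prodBernoulli w).real {ω : BondConfig (Fin n) | (∃ x ∈ ({o₁, o₂} : Finset (Fin n)), ω ∈ openConn v x) ∧
            (A.filter fun z => ω ∈ openConn v z).card ≤ j} ≤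
        (prodBernoulli w).real {ω : BondConfig (Fin n) | (A.filter fun z => ω ∈ openConn p z).card ≤ j})
    (w : Sym2 (Fin n) → unitInterval)
    (ho₁A : o₁ ∉ A) (ho₂A : o₂ ∉ A) (h12 : o₁ ≠ o₂) (hw12 : w s(o₁, o₂) = 0)
    (hpend₁ : ∀ u, w s(o₁, u) ≠ 0 → u ∈ A) (hpend₂ : ∀ u, w s(o₂, u) ≠ 0 → u ∈ A) :
    ∀ v ∈ A, ∃ p ∈ A, ((prodBernoulli w).real {ω : BondConfig (Fin n) | (∀ x ∈ ({o₁, o₂} : Finset (Fin n)), ω ∉ openConn v x) ∧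
          1 ≤ (A.filter fun z => ∃ x ∈ ({o₁, o₂} : Finset (Fin n)), ω ∈ openConn x z).card ∧
          (A.filter fun z => ∃ x ∈ ({o₁, o₂} : Finset (Fin n)), ω ∈ openConn x z).card ≤ j} +
        (prodBernoulli w).real {ω : BondConfig (Fin n) | (∃ x ∈ ({o₁, o₂} : Finset (Fin n)), ω ∈ openConn v x) ∧
          (A.filter fun z => ω ∈ openConn v z).card ≤ j} = 0 ∨ w s(o₁, p) ≠ 0 ∨ w s(o₂, p) ≠ 0) ∧
      (prodBernoulli w).real {ω : BondConfig (Fin n) | (∀ x ∈ ({o₁, o₂} : Finset (Fin n)), ω ∉ openConn v x) ∧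
          1 ≤ (A.filter fun z => ∃ x ∈ ({o₁, o₂} : Finset (Fin n)), ω ∈ openConn x z).card ∧
          (A.filter fun z => ∃ x ∈ ({o₁, o₂} : Finset (Fin n)), ω ∈ openConn x z).card ≤ j} +
        (prodBernoulli w).real {ω : BondConfig (Fin n) | (∃ x ∈ ({o₁, o₂} : Finset (Fin n)), ω ∈ openConn v x) ∧
          (A.filter fun z => ω ∈ openConn v z).card ≤ j} ≤
      (prodBernoulli w).real {ω : BondConfig (Fin n) | (A.filter fun z => ω ∈ openConn p z).card ≤ j} := by
  -- abbreviations (as functions of the weight function)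
  let Emass : (Sym2 (Fin n) → unitInterval) → Fin n → ℝ := fun u v =>
    (prodBernoulli u).real {ω : BondConfig (Fin n) | (∀ x ∈ ({o₁, o₂} : Finset (Fin n)), ω ∉ openConn v x) ∧
          1 ≤ (A.filter fun z => ∃ x ∈ ({o₁, o₂} : Finset (Fin n)), ω ∈ openConn x z).card ∧
          (A.filter fun z => ∃ x ∈ ({o₁, o₂} : Finset (Fin n)), ω ∈ openConn x z).card ≤ j} +
        (prodBernoulli u).real {ω : BondConfig (Fin n) | (∃ x ∈ ({o₁, o₂} : Finset (Fin n)), ω ∈ openConn v x) ∧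
          (A.filter fun z => ω ∈ openConn v z).card ≤ j}
  let Light : (Sym2 (Fin n) → unitInterval) → Fin n → ℝ := fun u p =>
    (prodBernoulli u).real {ω : BondConfig (Fin n) | (A.filter fun z => ω ∈ openConn p z).card ≤ j}
  let N : (Sym2 (Fin n) → unitInterval) → ℕ := fun u =>
    (A.filter fun x => u s(o₁, x) ≠ 0 ∧ u s(o₁, x) ≠ 1).card + (A.filter fun x => u s(o₂, x) ≠ 0 ∧ u s(o₂, x) ≠ 1).card
  -- the claim for all `w` with `N w ≤ K`, by induction on `K`
  suffices key : ∀ K : ℕ, ∀ u : Sym2 (Fin n) → unitInterval, u s(o₁, o₂) = 0 → (∀ x, u s(o₁, x) ≠ 0 → x ∈ A) →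
      (∀ x, u s(o₂, x) ≠ 0 → x ∈ A) → N u ≤ K →
      ∀ v ∈ A, ∃ p ∈ A, (Emass u v = 0 ∨ u s(o₁, p) ≠ 0 ∨ u s(o₂, p) ≠ 0) ∧ Emass u v ≤ Light u p by
    exact key (N w) w hw12 hpend₁ hpend₂ le_rfl
  intro K
  induction K with
  | zero =>
    intro u hu12 hp₁ hp₂ hN v hvA
    have hN0 : N u = 0 := Nat.le_zero.mp hN
    have hint : ∀ a ∈ A, (u s(o₁, a) = 0 ∨ u s(o₁, a) = 1) ∧ (u s(o₂, a) = 0 ∨ u s(o₂, a) = 1) := by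
      intro a ha
      have h1 : (A.filter fun x => u s(o₁, x) ≠ 0 ∧ u s(o₁, x) ≠ 1).card = 0 := by
        have : N u = (A.filter fun x => u s(o₁, x) ≠ 0 ∧ u s(o₁, x) ≠ 1).card +
          (A.filter fun x => u s(o₂, x) ≠ 0 ∧ u s(o₂, x) ≠ 1).card := rfl
        omega
      have h2 : (A.filter fun x => u s(o₂, x) ≠ 0 ∧ u s(o₂, x) ≠ 1).card = 0 := by
        have : N u = (A.filter fun x => u s(o₁, x) ≠ 0 ∧ u s(o₁, x) ≠ 1).card +
          (A.filter fun x => u s(o₂, x) ≠ 0 ∧ u s(o₂, x) ≠ 1).card := rfl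
        omega
      rw [Finset.card_eq_zero, Finset.filter_eq_empty_iff] at h1 h2
      constructor
      · by_contra hc; push Not at hc; exact h1 ha ⟨hc.1, hc.2⟩
      · by_contra hc; push Not at hc; exact h2 ha ⟨hc.1, hc.2⟩
    exact obsE_pair_le_port_of_integral u A o₁ o₂ j ho₁A ho₂A h12 hp₁ hp₂ hint v hvA
  | succ K ihK =>
    intro u hu12 hp₁ hp₂ hN v hvA
    -- (DC) one fractional pair down
    have IH : ∀ u' : Sym2 (Fin n) → unitInterval, u' s(o₁, o₂) = 0 → (∀ x, u' s(o₁, x) ≠ 0 → x ∈ A) →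
        (∀ x, u' s(o₂, x) ≠ 0 → x ∈ A) → N u' < N u →
        ∀ v ∈ A, ∃ p ∈ A, (Emass u' v = 0 ∨ u' s(o₁, p) ≠ 0 ∨ u' s(o₂, p) ≠ 0) ∧ Emass u' v ≤ Light u' p :=
      fun u' h1 h2 h3 hlt => ihK u' h1 h2 h3 (by omega)
    -- case 1: `v` has a fractional star pair
    by_cases hfrac : ∃ o ∈ ({o₁, o₂} : Finset (Fin n)), u s(o, v) ≠ 0 ∧ u s(o, v) ≠ 1
    · obtain ⟨o, ho, hne0, hne1⟩ := hfrac
      have hoA : o ∉ A := by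
        simp only [Finset.mem_insert, Finset.mem_singleton] at ho
        rcases ho with rfl | rfl
        · exact ho₁A
        · exact ho₂A
      have hvo : v ≠ o := fun h => hoA (h ▸ hvA)
      set u₀ := Function.update u s(v, o) 0 with hu₀
      have hkey : s(v, o) = s(o, v) := Sym2.eq_swap
      obtain ⟨hu₀12, hp₁', hp₂', hle₀, hNlt⟩ :=
        twoStars_erase u A o₁ o₂ o v ho₁A ho₂A ho hvA hu12 hp₁ hp₂ hne0 hne1
      obtain ⟨p, hpA, hp_or, hp_le⟩ := IH u₀ hu₀12 hp₁' hp₂' hNlt v hvA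
      have ho' : o ∈ ({o₁, o₂} : Finset (Fin n)) := ho
      -- the glued endpoint: `E_{u₁}(v) ≤ I_{u₁}(v)`
      have h1 : Emass (Function.update u s(v, o) 1) v ≤ Light (Function.update u s(v, o) 1) v :=
        obsE_weight_one_le (Function.update u s(v, o) 1) A {o₁, o₂} o v j ho' hvo (by simp)
      have hport_v : u s(o₁, v) ≠ 0 ∨ u s(o₂, v) ≠ 0 := by
        simp only [Finset.mem_insert, Finset.mem_singleton] at ho
        rcases ho with rfl | rfl
        · exact Or.inl hne0
        · exact Or.inr hne0
      by_cases hself : Emass u₀ v ≤ Light u₀ v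
      · -- `v` itself is a common witness
        exact ⟨v, hvA, Or.inr hport_v, obsE_le_of_common_witness u A {o₁, o₂} s(v, o) v v j hself h1⟩
      · -- the witness `p ≠ v` of the deleted endpoint, via the port step
        have hpv : p ≠ v := by intro h; rw [h] at hp_le; exact hself hp_le
        have hstep := obsE_le_max_of_erase u A {o₁, o₂} o v p j ho' hvo hpv hp_le
        have hp_port : u s(o₁, p) ≠ 0 ∨ u s(o₂, p) ≠ 0 := by
          rcases hp_or with h0 | h | h
          · exfalso; apply hself; rw [h0]; exact measureReal_nonneg
          · exact Or.inl (hle₀ _ h)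
          · exact Or.inr (hle₀ _ h)
        rcases le_total (Light u v) (Light u p) with hvp | hpv'
        · exact ⟨p, hpA, Or.inr hp_port, hstep.trans (by rw [max_eq_right hvp])⟩
        · exact ⟨v, hvA, Or.inr hport_v, hstep.trans (by rw [max_eq_left hpv'])⟩
    · push Not at hfrac
      -- case 2: `v` is a glued port
      by_cases hglued : ∃ o ∈ ({o₁, o₂} : Finset (Fin n)), u s(o, v) = 1
      · obtain ⟨o, ho, h1⟩ := hglued
        have hoA : o ∉ A := by
          simp only [Finset.mem_insert, Finset.mem_singleton] at ho
          rcases ho with rfl | rfl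
          · exact ho₁A
          · exact ho₂A
        have hvo : v ≠ o := fun h => hoA (h ▸ hvA)
        have hkey : s(v, o) = s(o, v) := Sym2.eq_swap
        have hport_v : u s(o₁, v) ≠ 0 ∨ u s(o₂, v) ≠ 0 := by
          simp only [Finset.mem_insert, Finset.mem_singleton] at ho
          rcases ho with rfl | rfl
          · left; rw [h1]; exact one_ne_zero
          · right; rw [h1]; exact one_ne_zero
        exact ⟨v, hvA, Or.inr hport_v, obsE_weight_one_le u A {o₁, o₂} o v j ho hvo (by rw [hkey]; exact h1)⟩
      · push Not at hglued
        -- case 3: `v` is an outsider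
        have hv₁ : u s(o₁, v) = 0 := by
          by_contra h; exact hglued o₁ (by simp) (hfrac o₁ (by simp) h)
        have hv₂ : u s(o₂, v) = 0 := by
          by_contra h; exact hglued o₂ (by simp) (hfrac o₂ (by simp) h)
        by_cases hex : ∃ a ∈ A, (u s(o₁, a) ≠ 0 ∧ u s(o₁, a) ≠ 1) ∨ (u s(o₂, a) ≠ 0 ∧ u s(o₂, a) ≠ 1)
        · exact hOut u ho₁A ho₂A h12 hu12 hp₁ hp₂ IH v hvA hv₁ hv₂ hex
        · -- no fractional pair at all: base case
          push Not at hex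
          have hint : ∀ a ∈ A, (u s(o₁, a) = 0 ∨ u s(o₁, a) = 1) ∧ (u s(o₂, a) = 0 ∨ u s(o₂, a) = 1) := by
            intro a ha
            obtain ⟨h1, h2⟩ := hex a ha
            constructor
            · by_cases h : u s(o₁, a) = 0
              · exact Or.inl h
              · exact Or.inr (h1 h)
            · by_cases h : u s(o₂, a) = 0
              · exact Or.inl h
              · exact Or.inr (h2 h)
          exact obsE_pair_le_port_of_integral u A o₁ o₂ j ho₁A ho₂A h12 hp₁ hp₂ hint v hvA

/-- **The OUTSIDER STEP from COND-OUT.**  If for every two-pendant-stars weight function with a fractional star pair and every relay `v`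
outside its ports there are a fractional star pair `e = s(a,o)` and a port `t` of `w` (possibly `a`) at least as light in `w[e↦0]` as every port of `w[e↦0]`
with `E_{w[e↦1]}(v) ≤ I_{w[e↦1]}(t)` (COND-OUT), then the outsider step holds: (DC) one pair down gives `E_{w[e↦0]}(v) ≤ I_{w[e↦0]}(t)`, and
`t` is a common witness (`obsE_le_of_common_witness`). [this work] -/
theorem outsiderStep_of_condOut (A : Finset (Fin n)) (o₁ o₂ : Fin n) (j : ℕ)
    (hCond : (∀ w : Sym2 (Fin n) → unitInterval, w s(o₁, o₂) = 0 → (∀ u, w s(o₁, u) ≠ 0 → u ∈ A) → (∀ u, w s(o₂, u) ≠ 0 → u ∈ A) →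
      ∀ v ∈ A, w s(o₁, v) = 0 → w s(o₂, v) = 0 →
      (∃ a ∈ A, (w s(o₁, a) ≠ 0 ∧ w s(o₁, a) ≠ 1) ∨ (w s(o₂, a) ≠ 0 ∧ w s(o₂, a) ≠ 1)) →
      ∃ o ∈ ({o₁, o₂} : Finset (Fin n)), ∃ a ∈ A, w s(o, a) ≠ 0 ∧ w s(o, a) ≠ 1 ∧ ∃ t ∈ A,
        (w s(o₁, t) ≠ 0 ∨ w s(o₂, t) ≠ 0) ∧
        (∀ p ∈ A, ((Function.update w s(a, o) 0) s(o₁, p) ≠ 0 ∨ (Function.update w s(a, o) 0) s(o₂, p) ≠ 0) →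
          (prodBernoulli (Function.update w s(a, o) 0)).real {ω : BondConfig (Fin n) | (A.filter fun z => ω ∈ openConn p z).card ≤ j} ≤
          (prodBernoulli (Function.update w s(a, o) 0)).real {ω : BondConfig (Fin n) | (A.filter fun z => ω ∈ openConn t z).card ≤ j}) ∧
        ((prodBernoulli (Function.update w s(a, o) 1)).real {ω : BondConfig (Fin n) | (∀ x ∈ ({o₁, o₂} : Finset (Fin n)), ω ∉ openConn v x) ∧
              1 ≤ (A.filter fun z => ∃ x ∈ ({o₁, o₂} : Finset (Fin n)), ω ∈ openConn x z).card ∧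
              (A.filter fun z => ∃ x ∈ ({o₁, o₂} : Finset (Fin n)), ω ∈ openConn x z).card ≤ j} +
            (prodBernoulli (Function.update w s(a, o) 1)).real {ω : BondConfig (Fin n) | (∃ x ∈ ({o₁, o₂} : Finset (Fin n)), ω ∈ openConn v x) ∧
              (A.filter fun z => ω ∈ openConn v z).card ≤ j}) ≤
        (prodBernoulli (Function.update w s(a, o) 1)).real {ω : BondConfig (Fin n) | (A.filter fun z => ω ∈ openConn t z).card ≤ j})) :
    (∀ w : Sym2 (Fin n) → unitInterval,
      o₁ ∉ A → o₂ ∉ A → o₁ ≠ o₂ → w s(o₁, o₂) = 0 → (∀ u, w s(o₁, u) ≠ 0 → u ∈ A) → (∀ u, w s(o₂, u) ≠ 0 → u ∈ A) →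
      (∀ w' : Sym2 (Fin n) → unitInterval, w' s(o₁, o₂) = 0 → (∀ u, w' s(o₁, u) ≠ 0 → u ∈ A) → (∀ u, w' s(o₂, u) ≠ 0 → u ∈ A) →
        ((A.filter fun x => w' s(o₁, x) ≠ 0 ∧ w' s(o₁, x) ≠ 1).card + (A.filter fun x => w' s(o₂, x) ≠ 0 ∧ w' s(o₂, x) ≠ 1).card) <
          ((A.filter fun x => w s(o₁, x) ≠ 0 ∧ w s(o₁, x) ≠ 1).card + (A.filter fun x => w s(o₂, x) ≠ 0 ∧ w s(o₂, x) ≠ 1).card) →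
        (∀ v ∈ A, ∃ p ∈ A, (((prodBernoulli w').real {ω : BondConfig (Fin n) | (∀ x ∈ ({o₁, o₂} : Finset (Fin n)), ω ∉ openConn v x) ∧
              1 ≤ (A.filter fun z => ∃ x ∈ ({o₁, o₂} : Finset (Fin n)), ω ∈ openConn x z).card ∧
              (A.filter fun z => ∃ x ∈ ({o₁, o₂} : Finset (Fin n)), ω ∈ openConn x z).card ≤ j} +
            (prodBernoulli w').real {ω : BondConfig (Fin n) | (∃ x ∈ ({o₁, o₂} : Finset (Fin n)), ω ∈ openConn v x) ∧
              (A.filter fun z => ω ∈ openConn v z).card ≤ j}) = 0 ∨ w' s(o₁, p) ≠ 0 ∨ w' s(o₂, p) ≠ 0) ∧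
          ((prodBernoulli w').real {ω : BondConfig (Fin n) | (∀ x ∈ ({o₁, o₂} : Finset (Fin n)), ω ∉ openConn v x) ∧
              1 ≤ (A.filter fun z => ∃ x ∈ ({o₁, o₂} : Finset (Fin n)), ω ∈ openConn x z).card ∧
              (A.filter fun z => ∃ x ∈ ({o₁, o₂} : Finset (Fin n)), ω ∈ openConn x z).card ≤ j} +
            (prodBernoulli w').real {ω : BondConfig (Fin n) | (∃ x ∈ ({o₁, o₂} : Finset (Fin n)), ω ∈ openConn v x) ∧
              (A.filter fun z => ω ∈ openConn v z).card ≤ j}) ≤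
          (prodBernoulli w').real {ω : BondConfig (Fin n) | (A.filter fun z => ω ∈ openConn p z).card ≤ j})) →
      ∀ v ∈ A, w s(o₁, v) = 0 → w s(o₂, v) = 0 →
      (∃ a ∈ A, (w s(o₁, a) ≠ 0 ∧ w s(o₁, a) ≠ 1) ∨ (w s(o₂, a) ≠ 0 ∧ w s(o₂, a) ≠ 1)) →
      ∃ p ∈ A, (((prodBernoulli w).real {ω : BondConfig (Fin n) | (∀ x ∈ ({o₁, o₂} : Finset (Fin n)), ω ∉ openConn v x) ∧
              1 ≤ (A.filter fun z => ∃ x ∈ ({o₁, o₂} : Finset (Fin n)), ω ∈ openConn x z).card ∧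
              (A.filter fun z => ∃ x ∈ ({o₁, o₂} : Finset (Fin n)), ω ∈ openConn x z).card ≤ j} +
            (prodBernoulli w).real {ω : BondConfig (Fin n) | (∃ x ∈ ({o₁, o₂} : Finset (Fin n)), ω ∈ openConn v x) ∧
              (A.filter fun z => ω ∈ openConn v z).card ≤ j}) = 0 ∨ w s(o₁, p) ≠ 0 ∨ w s(o₂, p) ≠ 0) ∧
        ((prodBernoulli w).real {ω : BondConfig (Fin n) | (∀ x ∈ ({o₁, o₂} : Finset (Fin n)), ω ∉ openConn v x) ∧
              1 ≤ (A.filter fun z => ∃ x ∈ ({o₁, o₂} : Finset (Fin n)), ω ∈ openConn x z).card ∧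
              (A.filter fun z => ∃ x ∈ ({o₁, o₂} : Finset (Fin n)), ω ∈ openConn x z).card ≤ j} +
            (prodBernoulli w).real {ω : BondConfig (Fin n) | (∃ x ∈ ({o₁, o₂} : Finset (Fin n)), ω ∈ openConn v x) ∧
              (A.filter fun z => ω ∈ openConn v z).card ≤ j}) ≤
        (prodBernoulli w).real {ω : BondConfig (Fin n) | (A.filter fun z => ω ∈ openConn p z).card ≤ j}) := by
  intro w ho₁A ho₂A h12 hw12 hpend₁ hpend₂ IH v hvA hv₁ hv₂ hex
  obtain ⟨o, ho, a, haA, hne0, hne1, t, htA, htport, htmax, h1⟩ := hCond w hw12 hpend₁ hpend₂ v hvA hv₁ hv₂ hex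
  obtain ⟨h012, hp₁', hp₂', hle₀, hNlt⟩ := twoStars_erase w A o₁ o₂ o a ho₁A ho₂A ho haA hw12 hpend₁ hpend₂ hne0 hne1
  obtain ⟨p, hpA, hp_or, hp_le⟩ := IH (Function.update w s(a, o) 0) h012 hp₁' hp₂' hNlt v hvA
  have h0 : ((prodBernoulli (Function.update w s(a, o) 0)).real {ω : BondConfig (Fin n) | (∀ x ∈ ({o₁, o₂} : Finset (Fin n)), ω ∉ openConn v x) ∧
              1 ≤ (A.filter fun z => ∃ x ∈ ({o₁, o₂} : Finset (Fin n)), ω ∈ openConn x z).card ∧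
              (A.filter fun z => ∃ x ∈ ({o₁, o₂} : Finset (Fin n)), ω ∈ openConn x z).card ≤ j} +
            (prodBernoulli (Function.update w s(a, o) 0)).real {ω : BondConfig (Fin n) | (∃ x ∈ ({o₁, o₂} : Finset (Fin n)), ω ∈ openConn v x) ∧
              (A.filter fun z => ω ∈ openConn v z).card ≤ j}) ≤
      (prodBernoulli (Function.update w s(a, o) 0)).real {ω : BondConfig (Fin n) | (A.filter fun z => ω ∈ openConn t z).card ≤ j} := by
    rcases hp_or with h0 | h | h
    · rw [h0]; exact measureReal_nonneg
    · exact hp_le.trans (htmax p hpA (Or.inl h))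
    · exact hp_le.trans (htmax p hpA (Or.inr h))
  exact ⟨t, htA, Or.inr htport, obsE_le_of_common_witness w A {o₁, o₂} s(a, o) v t j h0 h1⟩

/-- **(DC) from COND-OUT.**  COND-OUT (for all two-pendant-stars weight functions on `Fin n` with relays `A`, observers `o₁, o₂`, level `j`)
implies (DC) for all of them: for every relay `v` there is a port `p` (or `E_w(v) = 0`) with `E_w(v) ≤ I_w(p)`. [this work] -/
theorem dc_of_condOut (A : Finset (Fin n)) (o₁ o₂ : Fin n) (j : ℕ)
    (hCond : (∀ w : Sym2 (Fin n) → unitInterval, w s(o₁, o₂) = 0 → (∀ u, w s(o₁, u) ≠ 0 → u ∈ A) → (∀ u, w s(o₂, u) ≠ 0 → u ∈ A) →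
      ∀ v ∈ A, w s(o₁, v) = 0 → w s(o₂, v) = 0 →
      (∃ a ∈ A, (w s(o₁, a) ≠ 0 ∧ w s(o₁, a) ≠ 1) ∨ (w s(o₂, a) ≠ 0 ∧ w s(o₂, a) ≠ 1)) →
      ∃ o ∈ ({o₁, o₂} : Finset (Fin n)), ∃ a ∈ A, w s(o, a) ≠ 0 ∧ w s(o, a) ≠ 1 ∧ ∃ t ∈ A,
        (w s(o₁, t) ≠ 0 ∨ w s(o₂, t) ≠ 0) ∧
        (∀ p ∈ A, ((Function.update w s(a, o) 0) s(o₁, p) ≠ 0 ∨ (Function.update w s(a, o) 0) s(o₂, p) ≠ 0) →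
          (prodBernoulli (Function.update w s(a, o) 0)).real {ω : BondConfig (Fin n) | (A.filter fun z => ω ∈ openConn p z).card ≤ j} ≤
          (prodBernoulli (Function.update w s(a, o) 0)).real {ω : BondConfig (Fin n) | (A.filter fun z => ω ∈ openConn t z).card ≤ j}) ∧
        ((prodBernoulli (Function.update w s(a, o) 1)).real {ω : BondConfig (Fin n) | (∀ x ∈ ({o₁, o₂} : Finset (Fin n)), ω ∉ openConn v x) ∧
              1 ≤ (A.filter fun z => ∃ x ∈ ({o₁, o₂} : Finset (Fin n)), ω ∈ openConn x z).card ∧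
              (A.filter fun z => ∃ x ∈ ({o₁, o₂} : Finset (Fin n)), ω ∈ openConn x z).card ≤ j} +
            (prodBernoulli (Function.update w s(a, o) 1)).real {ω : BondConfig (Fin n) | (∃ x ∈ ({o₁, o₂} : Finset (Fin n)), ω ∈ openConn v x) ∧
              (A.filter fun z => ω ∈ openConn v z).card ≤ j}) ≤
        (prodBernoulli (Function.update w s(a, o) 1)).real {ω : BondConfig (Fin n) | (A.filter fun z => ω ∈ openConn t z).card ≤ j}))
    (w : Sym2 (Fin n) → unitInterval)
    (ho₁A : o₁ ∉ A) (ho₂A : o₂ ∉ A) (h12 : o₁ ≠ o₂) (hw12 : w s(o₁, o₂) = 0)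
    (hpend₁ : ∀ u, w s(o₁, u) ≠ 0 → u ∈ A) (hpend₂ : ∀ u, w s(o₂, u) ≠ 0 → u ∈ A) :
    (∀ v ∈ A, ∃ p ∈ A, (((prodBernoulli w).real {ω : BondConfig (Fin n) | (∀ x ∈ ({o₁, o₂} : Finset (Fin n)), ω ∉ openConn v x) ∧
              1 ≤ (A.filter fun z => ∃ x ∈ ({o₁, o₂} : Finset (Fin n)), ω ∈ openConn x z).card ∧
              (A.filter fun z => ∃ x ∈ ({o₁, o₂} : Finset (Fin n)), ω ∈ openConn x z).card ≤ j} +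
            (prodBernoulli w).real {ω : BondConfig (Fin n) | (∃ x ∈ ({o₁, o₂} : Finset (Fin n)), ω ∈ openConn v x) ∧
              (A.filter fun z => ω ∈ openConn v z).card ≤ j}) = 0 ∨ w s(o₁, p) ≠ 0 ∨ w s(o₂, p) ≠ 0) ∧
          ((prodBernoulli w).real {ω : BondConfig (Fin n) | (∀ x ∈ ({o₁, o₂} : Finset (Fin n)), ω ∉ openConn v x) ∧
              1 ≤ (A.filter fun z => ∃ x ∈ ({o₁, o₂} : Finset (Fin n)), ω ∈ openConn x z).card ∧
              (A.filter fun z => ∃ x ∈ ({o₁, o₂} : Finset (Fin n)), ω ∈ openConn x z).card ≤ j} +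
            (prodBernoulli w).real {ω : BondConfig (Fin n) | (∃ x ∈ ({o₁, o₂} : Finset (Fin n)), ω ∈ openConn v x) ∧
              (A.filter fun z => ω ∈ openConn v z).card ≤ j}) ≤
          (prodBernoulli w).real {ω : BondConfig (Fin n) | (A.filter fun z => ω ∈ openConn p z).card ≤ j}) :=
  dc_of_outsiderStep A o₁ o₂ j (outsiderStep_of_condOut A o₁ o₂ j hCond) w ho₁A ho₂A h12 hw12 hpend₁ hpend₂

/-- **CIL for the two-pendant-stars observer from COND-OUT.**  The setting of `cil_twoPendantStars_of_TPS`: `o ∉ A` with positive-weight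
neighbours among the relays and two non-relays `s₁ ≠ s₂`, each with only relay neighbours apart from `o` and at least one of them; `q ∈ A` an
`H`-champion.  If COND-OUT holds for the two-pendant-stars weight functions with relays `A` and observers `s₁, s₂` (hypothesis `hCond`), then
`μ_w{1 ≤ N ≤ j} ≤ μ_w{|π(q)| ≤ j}`: (DC) for the reference weight function `w_o` (`dc_of_condOut`) gives a port `p` with `E_{w_o}(q) ≤ I_{w_o}(p) ≤
I_{w_o}(q)` (the champion dominates every relay), i.e. the hypothesis TPS of `cil_twoPendantStars_of_TPS`. [this work] -/
theorem cil_twoPendantStars_of_condOut (w : Sym2 (Fin n) → unitInterval) (A : Finset (Fin n)) (o s₁ s₂ q : Fin n) (j : ℕ)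
    (hoA : o ∉ A) (hs₁A : s₁ ∉ A) (hs₂A : s₂ ∉ A) (hs₁o : s₁ ≠ o) (hs₂o : s₂ ≠ o) (h12 : s₁ ≠ s₂)
    (hobs : ∀ v, w s(o, v) ≠ 0 → v ∈ A ∨ v = s₁ ∨ v = s₂)
    (hobs₁ : ∀ v, v ≠ o → w s(s₁, v) ≠ 0 → v ∈ A) (hobs₂ : ∀ v, v ≠ o → w s(s₂, v) ≠ 0 → v ∈ A)
    (hne₁ : ∃ v ∈ A, w s(s₁, v) ≠ 0) (hne₂ : ∃ v ∈ A, w s(s₂, v) ≠ 0)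
    (hqA : q ∈ A)
    (hchamp : ∀ a ∈ A,
      (prodBernoulli w).real {ω : BondConfig (Fin n) |
          (A.filter fun z => (openGraph (ω ∩ {e | o ∉ e})).Reachable a z).card ≤ j} ≤
        (prodBernoulli w).real {ω : BondConfig (Fin n) |
          (A.filter fun z => (openGraph (ω ∩ {e | o ∉ e})).Reachable q z).card ≤ j})
    (hCond : (∀ w' : Sym2 (Fin n) → unitInterval, w' s(s₁, s₂) = 0 → (∀ u, w' s(s₁, u) ≠ 0 → u ∈ A) → (∀ u, w' s(s₂, u) ≠ 0 → u ∈ A) →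
      ∀ v ∈ A, w' s(s₁, v) = 0 → w' s(s₂, v) = 0 →
      (∃ a ∈ A, (w' s(s₁, a) ≠ 0 ∧ w' s(s₁, a) ≠ 1) ∨ (w' s(s₂, a) ≠ 0 ∧ w' s(s₂, a) ≠ 1)) →
      ∃ o' ∈ ({s₁, s₂} : Finset (Fin n)), ∃ a ∈ A, w' s(o', a) ≠ 0 ∧ w' s(o', a) ≠ 1 ∧ ∃ t ∈ A,
        (w' s(s₁, t) ≠ 0 ∨ w' s(s₂, t) ≠ 0) ∧
        (∀ p ∈ A, ((Function.update w' s(a, o') 0) s(s₁, p) ≠ 0 ∨ (Function.update w' s(a, o') 0) s(s₂, p) ≠ 0) →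
          (prodBernoulli (Function.update w' s(a, o') 0)).real {ω : BondConfig (Fin n) | (A.filter fun z => ω ∈ openConn p z).card ≤ j} ≤
          (prodBernoulli (Function.update w' s(a, o') 0)).real {ω : BondConfig (Fin n) | (A.filter fun z => ω ∈ openConn t z).card ≤ j}) ∧
        ((prodBernoulli (Function.update w' s(a, o') 1)).real {ω : BondConfig (Fin n) | (∀ x ∈ ({s₁, s₂} : Finset (Fin n)), ω ∉ openConn v x) ∧
              1 ≤ (A.filter fun z => ∃ x ∈ ({s₁, s₂} : Finset (Fin n)), ω ∈ openConn x z).card ∧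
              (A.filter fun z => ∃ x ∈ ({s₁, s₂} : Finset (Fin n)), ω ∈ openConn x z).card ≤ j} +
            (prodBernoulli (Function.update w' s(a, o') 1)).real {ω : BondConfig (Fin n) | (∃ x ∈ ({s₁, s₂} : Finset (Fin n)), ω ∈ openConn v x) ∧
              (A.filter fun z => ω ∈ openConn v z).card ≤ j}) ≤
        (prodBernoulli (Function.update w' s(a, o') 1)).real {ω : BondConfig (Fin n) | (A.filter fun z => ω ∈ openConn t z).card ≤ j})) :
    (prodBernoulli w).real {ω : BondConfig (Fin n) |
        1 ≤ (A.filter fun x => ω ∈ openConn o x).card ∧ (A.filter fun x => ω ∈ openConn o x).card ≤ j} ≤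
      (prodBernoulli w).real {ω : BondConfig (Fin n) | (A.filter fun x => ω ∈ openConn q x).card ≤ j} := by
  set wo : Sym2 (Fin n) → unitInterval := fun e => if e ∈ {e : Sym2 (Fin n) | o ∉ e} then w e else 0 with hwo
  have hwo_of : ∀ u v : Fin n, o ∉ s(u, v) → wo s(u, v) = w s(u, v) := by
    intro u v h
    simp only [hwo, Set.mem_setOf_eq, h, not_false_eq_true, if_true]
  have hwo_zero : ∀ u v : Fin n, o ∈ s(u, v) → wo s(u, v) = 0 := by
    intro u v h
    have : ¬ (o ∉ s(u, v)) := fun h' => h' h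
    simp only [hwo, Set.mem_setOf_eq, this, if_false]
  -- the two-pendant-stars shape of `w_o`
  have hw12 : wo s(s₁, s₂) = 0 := by
    by_cases h : o ∈ s(s₁, s₂)
    · exact hwo_zero s₁ s₂ h
    · rw [hwo_of s₁ s₂ h]
      by_contra hne
      exact hs₂A (hobs₁ s₂ hs₂o hne)
  have hpend : ∀ s : Fin n, (∀ v, v ≠ o → w s(s, v) ≠ 0 → v ∈ A) → ∀ u, wo s(s, u) ≠ 0 → u ∈ A := by
    intro s hs u hu
    by_cases h : o ∈ s(s, u)
    · exact absurd (hwo_zero s u h) hu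
    · have huo : u ≠ o := fun h' => h (h' ▸ Sym2.mem_mk_right s u)
      rw [hwo_of s u h] at hu
      exact hs u huo hu
  obtain ⟨p, hpA, hp_or, hp_le⟩ :=
    dc_of_condOut A s₁ s₂ j hCond wo hs₁A hs₂A h12 hw12 (hpend s₁ hobs₁) (hpend s₂ hobs₂) q hqA
  -- the champion dominates the port `p` in `w_o`
  have hIq : (prodBernoulli wo).real {ω : BondConfig (Fin n) | (A.filter fun z => ω ∈ openConn p z).card ≤ j} ≤
      (prodBernoulli wo).real {ω : BondConfig (Fin n) | (A.filter fun z => ω ∈ openConn q z).card ≤ j} := by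
    have h := hchamp p hpA
    rw [TwoPendantStars.real_lightness_avoid w A o p j, TwoPendantStars.real_lightness_avoid w A o q j] at h
    exact h
  have hE := hp_le.trans hIq
  refine cil_twoPendantStars_of_TPS w A o s₁ s₂ q j hoA hs₁A hs₂A hs₁o hs₂o hobs hobs₁ hobs₂ hne₁ hne₂ hqA hchamp ?_
  have hCS := setCS_of_obsE_le wo A {s₁, s₂} q j hE
  convert hCS using 12

end HullPort

end Summit.CriticalPhenomena.PercolationContinuityZ3.Theorems

end
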